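import Summits.Ventures.PercRepro.RankLevelSetRuleQSliceBorderMid
import Summits.Ventures.PercRepro.RankLevelSetRuleQSliceBorderEven

/-!
# PercRepro — THE UNIFORM BORDERLINE FROM `k ≥ 20` (night-1, gen 20; dossier §31.10)

`phiK_le_rhat_border_large` (`k ≥ 23`) together with the gap-free families `k = 20, 22` (`border_even_k20`, `border_even_k22`,
RankLevelSetRuleQSliceBorderEven) and `k = 21` (`border_k21`, RankLevelSetRuleQSliceBorderMid):
**`phiK_le_rhat_border_twenty (k q) (20 ≤ k) (k(k−3) ≤ 2q) : phiK (q + k) q ≤ rhat q k (q − (k − 2))`** — for every family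
`k ≥ 20` and every `q ≥ k(k−3)/2`, Rule Q's equal split pays the borderline members of the cell `(q+k, q)`; with
`rhat_le_ruleQRecv` this holds in every finite matroid (`ruleQRecv_ge_phiK_border_twenty`). Axioms: standard.
-/

namespace PercRepro

open Finset

/-- **THE UNIFORM BORDERLINE FROM `k ≥ 20`**: `Φ(q+k, q) ≤ R̂(q, k, q − (k − 2))` for every `k ≥ 20` and `q ≥ k(k−3)/2`. -/
theorem phiK_le_rhat_border_twenty (k q : ℕ) (hk : 20 ≤ k) (hq : k * (k - 3) ≤ 2 * q) :
    phiK (q + k) q ≤ rhat q k (q - (k - 2)) := by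
  rcases Nat.lt_or_ge k 23 with h | h
  · interval_cases k
    · exact border_even_k20 q (by omega)
    · exact border_k21 q (by omega)
    · exact border_even_k22 q (by omega)
  · exact phiK_le_rhat_border_large k q h hq

/-- The matroid level of `phiK_le_rhat_border_twenty`. -/
theorem ruleQRecv_ge_phiK_border_twenty {β : Type} (M : Matroid β) [M.Finite] {q k : ℕ} (hk : 20 ≤ k)
    (hq : k * (k - 3) ≤ 2 * q) (hE : M.E.ncard = (q + k) + q) {Z : Set β} (hZ : Z ∈ cellMembers M (q + k) q)
    (hP : (flatPart M Z).ncard = q - (k - 2)) :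
    phiK (q + k) q ≤ ruleQRecv M (q + k) q Z :=
  ruleQRecv_ge_phiK_border_of_rhat M (phiK_le_rhat_border_twenty k q hk hq) hE hZ hP

end PercRepro
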